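import Summits.CriticalPhenomena.PercolationContinuityZ3.Theorems.PercNearOneGluingNoHeavyLowerTailSahiTriangleStaircaseTwo
import Summits.CriticalPhenomena.PercolationContinuityZ3.Theorems.PercNearOneGluingNoHeavyLowerTailSahiTriangleStaircaseTwoAtomsFull
import HarnessLib

/-!
# `NoHeavyLowerTail` (crux stmt-CriticalPhenomena-4575), P2 — Sahi's `C_3` for the GENERAL two-step staircase member of class T

Memo SAHI-ROUTE.md §4.23(g) (seat `prim-masterthm-p2`, gen 7; `--supports stmt-CriticalPhenomena-4575`).  No `sorry`, no named facts.

SETTING (class T): finite distributive lattices `α, β, γ` with FKG probability weights `wA, wB, wC`; `g : γ → β → ℝ`, `h : α → β → ℝ`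
nonnegative and coordinatewise monotone (arbitrary); third member the two-step staircase
`f(c,a) = φ₁(c)ψ₁(a) + (φ₂(c) − φ₁(c))ψ₂(a)`, `0 ≤ φ₁ ≤ φ₂ ≤ 1` monotone on `γ`, `0 ≤ ψ₂ ≤ ψ₁ ≤ 1` monotone on `α`
(events: `f = 1_{(U₁×V₁) ∪ (U₂×V₂)}` with `U₁ ⊆ U₂`, `V₁ ⊇ V₂` increasing — the members that are neither cross-super- nor cross-submodular).

**THEOREM `sahiE_three_nonneg_of_staircaseTwo`: `E_3(f,g,h) ≥ 0`** — unconditionally (it contains the product members `φ₁ ≡ 0`/`ψ₂ ≡ 0`,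
the OR member `φ₂ ≡ 1 ∧ ψ₁ ≡ 1` and `…SahiTriangleStaircase` (`ψ₁ ≡ 1`) as degenerate cases).
PROOF: the β-reduction `sahiE_three_eq_E3` + `bounds_atomsOf` (file `…StaircaseTwo`) and the atom-level theorem `Atoms.E3_nonneg_all`
(files `…StaircaseTwoAtoms`, `…StaircaseTwoAtomsFull`): free case `a₁ ≤ a₂` by the `T₁+T₂+T₃` split, hard case by the entangled identity H on
`P₁Q₁ ≤ (1−P₂)Q₂` and identities A/B on `Q₂ ≤ P₁Q₁ + P₂Q₂`, boundary strata by four more identities.  This settles the `K = 2` case of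
CONJECTURE STAIR (SAHI-ROUTE §4.23).
-/

noncomputable section

open scoped Classical

namespace Summit.CriticalPhenomena.PercolationContinuityZ3.Theorems

namespace SahiTriangleStaircaseTwo

open Literature.Combinatorics.Sahi2008

variable {α β γ : Type} [Fintype α] [Fintype β] [Fintype γ]
  (wA : α → ℝ) (wB : β → ℝ) (wC : γ → ℝ) (φ₁ φ₂ : γ → ℝ) (ψ₁ ψ₂ : α → ℝ) (g : γ → β → ℝ) (h : α → β → ℝ)

/-- **THEOREM (Sahi's `C_3` for the general two-step staircase member of class T).**  See the module docstring. [this work] -/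
theorem sahiE_three_nonneg_of_staircaseTwo [DistribLattice α] [DistribLattice β] [DistribLattice γ]
    (hA : IsFKGMeasure wA) (hB : IsFKGMeasure wB) (hC : IsFKGMeasure wC)
    (hφ0 : ∀ c, 0 ≤ φ₁ c) (hφle : ∀ c, φ₁ c ≤ φ₂ c) (hφ1 : ∀ c, φ₂ c ≤ 1) (hφ1m : Monotone φ₁) (hφ2m : Monotone φ₂)
    (hψ0 : ∀ a, 0 ≤ ψ₂ a) (hψle : ∀ a, ψ₂ a ≤ ψ₁ a) (hψ1 : ∀ a, ψ₁ a ≤ 1) (hψ1m : Monotone ψ₁) (hψ2m : Monotone ψ₂)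
    (hg0 : ∀ c b, 0 ≤ g c b) (hgb : ∀ c, Monotone (g c)) (hgc : ∀ b, Monotone (fun c => g c b))
    (hh0 : ∀ a b, 0 ≤ h a b) (hha : ∀ b, Monotone (fun a => h a b)) (hhb : ∀ a, Monotone (h a)) :
    0 ≤ sahiE (fun p : α × β × γ => wA p.1 * wB p.2.1 * wC p.2.2) 3
        ![fun p => φ₁ p.2.2 * ψ₁ p.1 + (φ₂ p.2.2 - φ₁ p.2.2) * ψ₂ p.1, fun p => g p.2.2 p.2.1, fun p => h p.1 p.2.1] := by
  rw [sahiE_three_eq_E3 wA wB wC φ₁ φ₂ ψ₁ ψ₂ g h hA.sum_eq_one hB.sum_eq_one hC.sum_eq_one]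
  exact Atoms.E3_nonneg_all
    (bounds_atomsOf hA hB hC hφ0 hφle hφ1 hφ1m hφ2m hψ0 hψle hψ1 hψ1m hψ2m hg0 hgb hgc hh0 hha hhb)


section Cubes

variable {A B C : Type} [Fintype A] [Fintype B] [Fintype C]

/-- **Three Boolean cubes with product measures, general two-step staircase member** ⇒ `E_3(φ₁⊗ψ₁ + (φ₂−φ₁)⊗ψ₂, g, h) ≥ 0`. [this work] -/
theorem sahiE_three_nonneg_cubes_of_staircaseTwo (pA : A → unitInterval) (pB : B → unitInterval) (pC : C → unitInterval)
    (φ₁ φ₂ : Set C → ℝ) (ψ₁ ψ₂ : Set A → ℝ) (g : Set C → Set B → ℝ) (h : Set A → Set B → ℝ)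
    (hφ0 : ∀ c, 0 ≤ φ₁ c) (hφle : ∀ c, φ₁ c ≤ φ₂ c) (hφ1 : ∀ c, φ₂ c ≤ 1) (hφ1m : Monotone φ₁) (hφ2m : Monotone φ₂)
    (hψ0 : ∀ a, 0 ≤ ψ₂ a) (hψle : ∀ a, ψ₂ a ≤ ψ₁ a) (hψ1 : ∀ a, ψ₁ a ≤ 1) (hψ1m : Monotone ψ₁) (hψ2m : Monotone ψ₂)
    (hg0 : ∀ c b, 0 ≤ g c b) (hgb : ∀ c, Monotone (g c)) (hgc : ∀ b, Monotone (fun c => g c b))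
    (hh0 : ∀ a b, 0 ≤ h a b) (hha : ∀ b, Monotone (fun a => h a b)) (hhb : ∀ a, Monotone (h a)) :
    0 ≤ sahiE (fun p : Set A × Set B × Set C =>
        bernoulliWeight pA p.1 * bernoulliWeight pB p.2.1 * bernoulliWeight pC p.2.2) 3
        ![fun p => φ₁ p.2.2 * ψ₁ p.1 + (φ₂ p.2.2 - φ₁ p.2.2) * ψ₂ p.1, fun p => g p.2.2 p.2.1, fun p => h p.1 p.2.1] :=
  sahiE_three_nonneg_of_staircaseTwo (bernoulliWeight pA) (bernoulliWeight pB) (bernoulliWeight pC) φ₁ φ₂ ψ₁ ψ₂ g h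
    (isFKGMeasure_bernoulliWeight pA) (isFKGMeasure_bernoulliWeight pB) (isFKGMeasure_bernoulliWeight pC)
    hφ0 hφle hφ1 hφ1m hφ2m hψ0 hψle hψ1 hψ1m hψ2m hg0 hgb hgc hh0 hha hhb

end Cubes

end SahiTriangleStaircaseTwo

end Summit.CriticalPhenomena.PercolationContinuityZ3.Theorems

end
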